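import Literature.AlgebraicGeometry.Frobenioids.EquivalenceThm34Assembly
import Literature.AlgebraicGeometry.Frobenioids.EquivalenceUnitsStandardTypeClosed
import HarnessLib

/-!
# Frobenioids I, Theorem 3.4 (iv), preservation part AS TYPED, for every pair of Frobenioids over
# bases of FSM-type (capstone: the units clause supplied)

Mochizuki, *The geometry of Frobenioids I: the general theory*, Kyushu J. Math. **62** (2008)
293–400, Thm. 3.4 (iv) p. 62 l. 36 – p. 63 l. 4 [cite: MochizukiFrdI2008, Thm. 3.4 (iv) p.63]:

> "(iv) Suppose that: (a) `C_1`, `C_2` are of standard type; (b) if `C_1`, `C_2` are of group-like type,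
> then both `Ψ` and some quasi-inverse to `Ψ` preserve base-isomorphisms; (c) `D_1`, `D_2` are
> Frobenius-slim. Then `Ψ` preserves the submonoids "`O^▷(−)`", "`O^×(−)`"; `Ψ^{ℕ_{≥1}}` is the identity
> automorphism."

PROOF-ONLY file (abc-iut cell, node `FrdI:Thm3.4(iv)`; seat abc-iut-w4-d093). Seat abc-iut-w4-d033's
`FrdI.thm34iv_ofFunctor_of_isOfFSMType_of_units` (`EquivalenceThm34Assembly.lean`) reduces the typed statement
`PreFrobenioidData.Thm34iv (ofFunctor Φ₁ F₁) (ofFunctor Φ₂ F₂) Ψ` (seat abc-iut-L1-t3,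
`BaseCategoryTheoreticity.lean`) over FSM-type bases to its units clause (sub-DAG row L08); that clause is
`FrdI.thm34iv_units` (`EquivalenceUnitsStandardTypeClosed.lean`, printed route p. 66 via Prop. 3.3 (i)).
Composing the two: `FrdI.thm34iv_ofFunctor_of_isOfFSMType` — the typed Thm. 3.4 (iv) (preservation of
`O^▷(−)`, `O^×(−)` and of Frobenius degrees) for EVERY pair of Frobenioids `C_i → F_{Φ_i}` over bases of
FSM-type, the cell's repaired base hypothesis (print: FSMFF; the printed route of Thm. 3.4 (ii) is kernel-checked
for FSM-type bases only — residual R2 of plan/L1/SUBDAG-FrdI-Thm34.md, plan/GAP-LEDGER.md). The hypotheses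
(a), (b), (c) are those INSIDE the typed statement; only (c) for `D₂` is used. Nothing of [FrdI] is restated as a
named fact; no statement of the paper is strengthened.
-/

namespace Literature.AlgebraicGeometry.Frobenioids

open CategoryTheory Opposite

namespace FrdI

universe w v v' u u'

variable {D₁ : Type u} [Category.{v} D₁] {Φ₁ : D₁ᵒᵖ ⥤ CommMonCat.{w}} {C₁ : Type u'} [Category.{v'} C₁]
  {D₂ : Type u} [Category.{v} D₂] {Φ₂ : D₂ᵒᵖ ⥤ CommMonCat.{w}} {C₂ : Type u'} [Category.{v'} C₂]
  {F₁ : C₁ ⥤ ElemFrobenioid Φ₁} {F₂ : C₂ ⥤ ElemFrobenioid Φ₂}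

/-- **[FrdI] Thm. 3.4 (iv), preservation part, AS TYPED** (`PreFrobenioidData.Thm34iv` at the operations
`ofFunctor` of two Frobenioids), for every pair of Frobenioids over bases of FSM-type and every equivalence
`Ψ : C₁ ⥲ C₂`: under (a) standard type, (b) `HypB`, (c) Frobenius-slim bases, `Ψ` preserves `O^▷(−)`,
`O^×(−)` and Frobenius degrees (`Ψ^{ℕ_{≥1}} = id`). [cite: MochizukiFrdI2008, Thm. 3.4 (iv) p.63] -/
theorem thm34iv_ofFunctor_of_isOfFSMType (hF₁ : PreFrobenioid.IsFrobenioid F₁)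
    (hF₂ : PreFrobenioid.IsFrobenioid F₂) (hD₁ : IsOfFSMType D₁) (hD₂ : IsOfFSMType D₂) (Ψ : C₁ ≌ C₂) :
    (PreFrobenioidData.ofFunctor Φ₁ F₁).Thm34iv (PreFrobenioidData.ofFunctor Φ₂ F₂) Ψ :=
  thm34iv_ofFunctor_of_isOfFSMType_of_units hF₁ hF₂ hD₁ hD₂ Ψ fun hs₁ hs₂ hB _ hsl₂ =>
    thm34iv_units hF₁ hF₂ hs₁ hs₂ hD₁ hD₂ Ψ hB hsl₂

end FrdI

end Literature.AlgebraicGeometry.Frobenioids
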